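import Summits.BirchSwinnertonDyer.Rank1Residual.P2.CongruentNumberOddAokiMonskySevenPrep
import Summits.BirchSwinnertonDyer.Rank1Residual.P2.CongruentNumberOddAokiMonskyThree
import HarnessLib

/-!
# Cell `bsd-monsky`: AOKI = MONSKY, THE ODD CLASS `n ≡ 7 (mod 8)` — `Λ_{S,T} ≅ [Aᵀ|_{T₁} | t]` and the rank of
# Aoki's Gram form on `W₇ = W₀ ∩ ker(t ⬝ ·) ∩ ker(ε ⬝ ·)` (pure bookkeeping / linear algebra; nothing asserted)

HONEST FRAMING (cell `bsd-monsky`, run/shared/lean/pub/bsd-monsky/, README §1). This file asserts NO arithmetic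
fact. For `n = p₁⋯p_k ≡ 7 (mod 8)` (plan HOME/proof/PROOF-B-AOKI-MONSKY.md §5.1):
* §1 `rank_lamMatrix_prod_seven_eq` — Aoki's `Λ_{S,T}` (`T = T₁ ∪ {2}`, the column of `2` being `λ₂(p_i) = t_i`)
  reindexes to `[C | t]`, `C = Aᵀ|_{ι × T₁}`; with `rank_fromCols_single` its rank is `rank C + [t ∉ col C]`;
* §2 `rank_gram_seven_add` — for the Gram form `B = toBilin' G` (`G_il = Σ_j ε_j (Aᵀ)_ij (Aᵀ)_lj + δ_il t_i`):
  `rank(G|W₇) + 2·[t ∉ col C] = rank(G|W₀)`. Indeed `t ∈ col C ⟺ 𝟙 ∈ rad W₀` (col `C` = annihilator of `W₀`,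
  `B(𝟙, ·) = t ⬝ ·`); if `𝟙 ∉ rad W₀` the isotropic vector `𝟙` (`B(𝟙,𝟙) = Σ t = 0`) costs `2` (R3 on `ker B(𝟙,·)`,
  then R1 for `ε ⬝ ·` with `ε ⬝ 𝟙 = Σ ε = 1`); if `𝟙 ∈ rad W₀` then `ker(t ⬝ ·) ⊇ W₀` and `ε ⬝ ·` costs nothing (R1).
The assembly with Aoki's essential space (`essentialCond_prod_seven_iff`) is the remaining step.

References: [Aoki1999] Thm. 2.2 p. 81, §2 p. 80; [HeathBrown1994SelmerCongruentII] Appendix (Monsky), p. 39.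
-/

noncomputable section

open scoped Classical

open Matrix WeierstrassCurve Literature.NumberTheory.EllipticCurves
  Literature.NumberTheory.EllipticCurves.Aoki1999
  Literature.NumberTheory.EllipticCurves.HeathBrown1994
  Literature.NumberTheory.EllipticCurves.HeathBrown1994.Families
  Literature.NumberTheory.QuadraticForms

set_option autoImplicit false

namespace Summit.BirchSwinnertonDyer.Rank1Residual.P2.AokiMonsky

variable {k : ℕ} (p : Fin k → ℕ) (hp : ∀ i, (p i).Prime) (hinj : Function.Injective p)

/-! ## §1 `Λ_{S,T} ≅ [C | t]` for `n ≡ 7 (mod 8)` -/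

include hp hinj in
/-- **`rank Λ_{S,T} = rank [Aᵀ|_{ι×T₁} | t]`** for `n ≡ 7 (mod 8)` (`S = {p_i}`, `T = T₁ ∪ {2}`, `λ_{p_j}(p_i) = (Aᵀ)_ij`,
`λ₂(p_i) = t_i`). [cite: Aoki1999, Thm. 2.2 p. 81, §2 p. 80] -/
theorem rank_lamMatrix_prod_seven_eq (h7 : (∏ i, p i) % 8 = 7) :
    (lamMatrix (∏ i, p i) (sSet (∏ i, p i)) (tSet (∏ i, p i))).rank =
      (Matrix.fromCols
        ((legendreMatrix p)ᵀ.submatrix id (Subtype.val : {j // addLegendreSym (-1) (p j) = 0} → Fin k))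
        (Matrix.of fun (i : Fin k) (_ : Unit) => addLegendreSym 2 (p i))).rank := by
  have hodd := odd_of_prod_odd p (by omega)
  have hS := sSet_prod p hp hinj
  have hT := tSet_prod_seven p hp hinj h7
  have hmemS : ∀ i, p i ∈ sSet (∏ i, p i) := fun i => by
    rw [hS]; exact Finset.mem_image_of_mem _ (Finset.mem_univ i)
  have hmemT : ∀ j : {j // addLegendreSym (-1) (p j) = 0}, p j.1 ∈ tSet (∏ i, p i) := fun j => by
    rw [hT]
    exact Finset.mem_insert_of_mem (Finset.mem_image_of_mem _ (Finset.mem_filter.mpr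
      ⟨Finset.mem_univ _, (eps_eq_zero_iff p hodd j.1).mp j.2⟩))
  have hmem2 : 2 ∈ tSet (∏ i, p i) := by rw [hT]; exact Finset.mem_insert_self _ _
  let eS : Fin k ≃ ↥(sSet (∏ i, p i)) := Equiv.ofBijective (fun i => ⟨p i, hmemS i⟩)
    ⟨fun i j h => hinj (Subtype.ext_iff.mp h), fun x => by
      obtain ⟨xv, hxv⟩ := x
      rw [hS] at hxv
      obtain ⟨i, -, hi⟩ := Finset.mem_image.mp hxv
      exact ⟨i, Subtype.ext hi⟩⟩
  let fT : {j // addLegendreSym (-1) (p j) = 0} ⊕ Unit → ↥(tSet (∏ i, p i)) :=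
    Sum.elim (fun j => ⟨p j.1, hmemT j⟩) (fun _ => ⟨2, hmem2⟩)
  have hfT : Function.Bijective fT := by
    constructor
    · rintro (j | u) (j' | u') h
      · exact congrArg Sum.inl (Subtype.ext (hinj (Subtype.ext_iff.mp h)))
      · exact absurd (Subtype.ext_iff.mp h) (prime_ne_two p hodd j.1)
      · exact absurd (Subtype.ext_iff.mp h).symm (prime_ne_two p hodd j'.1)
      · cases u; cases u'; rfl
    · intro x
      obtain ⟨xv, hxv⟩ := x
      rw [hT] at hxv
      rcases Finset.mem_insert.mp hxv with h2 | hx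
      · exact ⟨Sum.inr (), Subtype.ext h2.symm⟩
      · obtain ⟨i, hi, hix⟩ := Finset.mem_image.mp hx
        exact ⟨Sum.inl ⟨i, (eps_eq_zero_iff p hodd i).mpr (Finset.mem_filter.mp hi).2⟩, Subtype.ext hix⟩
  let eT : {j // addLegendreSym (-1) (p j) = 0} ⊕ Unit ≃ ↥(tSet (∏ i, p i)) := Equiv.ofBijective fT hfT
  have h2 : (lamMatrix (∏ i, p i) (sSet (∏ i, p i)) (tSet (∏ i, p i))).submatrix eS eT =
      Matrix.fromCols
        ((legendreMatrix p)ᵀ.submatrix id (Subtype.val : {j // addLegendreSym (-1) (p j) = 0} → Fin k))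
        (Matrix.of fun (i : Fin k) (_ : Unit) => addLegendreSym 2 (p i)) := by
    ext i (j | u)
    · change lam (∏ i, p i) (p j.1) ((p i : ℕ) : ℤ) = _
      rw [Matrix.fromCols_apply_inl, Matrix.submatrix_apply, id,
        lam_odd_eq_transpose_legendreMatrix p hp hodd hinj i j.1]
    · change lam (∏ i, p i) 2 ((p i : ℕ) : ℤ) = _
      rw [Matrix.fromCols_apply_inr, Matrix.of_apply, lam_two_prime p hp hodd]
  rw [← h2, Matrix.rank_submatrix]

/-! ## §2 The rank of Aoki's Gram form on `W₇ = W₀ ∩ ker(t ⬝ ·) ∩ ker(ε ⬝ ·)` -/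

/-- **`rank(G|W₇) + 2·[t ∉ col C] = rank(G|W₀)`** for `n ≡ 7 (mod 8)`. [cite: Aoki1999, Thm. 2.2 p. 81] -/
theorem rank_gram_seven_add (h7 : (∏ i, p i) % 8 = 7) :
    (Matrix.of fun w w' : ↥(Finset.univ.filter fun u : Fin k → ZMod 2 =>
          (∀ j, addLegendreSym (-1) (p j) = 0 → (u ᵥ* (legendreMatrix p)ᵀ) j = 0) ∧
            (fun i => addLegendreSym 2 (p i)) ⬝ᵥ u = 0 ∧ (fun i => addLegendreSym (-1) (p i)) ⬝ᵥ u = 0) =>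
        (w : Fin k → ZMod 2) ⬝ᵥ ((Matrix.of fun i l : Fin k =>
          (∑ j, addLegendreSym (-1) (p j) * ((legendreMatrix p)ᵀ i j * (legendreMatrix p)ᵀ l j)) +
            if i = l then addLegendreSym 2 (p i) else 0) *ᵥ (w' : Fin k → ZMod 2))).rank +
      2 * (if (fun i => addLegendreSym 2 (p i)) ∈ LinearMap.range
            ((legendreMatrix p)ᵀ.submatrix id
              (Subtype.val : {j // addLegendreSym (-1) (p j) = 0} → Fin k)).mulVecLin then 0 else 1) =
      (Matrix.of fun w w' : ↥(Finset.univ.filter fun u : Fin k → ZMod 2 =>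
          ∀ j, addLegendreSym (-1) (p j) = 0 → (u ᵥ* (legendreMatrix p)ᵀ) j = 0) =>
        (w : Fin k → ZMod 2) ⬝ᵥ ((Matrix.of fun i l : Fin k =>
          (∑ j, addLegendreSym (-1) (p j) * ((legendreMatrix p)ᵀ i j * (legendreMatrix p)ᵀ l j)) +
            if i = l then addLegendreSym 2 (p i) else 0) *ᵥ (w' : Fin k → ZMod 2))).rank := by
  have hodd := odd_of_prod_odd p (by omega)
  set L : Matrix (Fin k) (Fin k) (ZMod 2) := (legendreMatrix p)ᵀ with hL
  set G : Matrix (Fin k) (Fin k) (ZMod 2) := Matrix.of fun i l : Fin k =>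
    (∑ j, addLegendreSym (-1) (p j) * (L i j * L l j)) + if i = l then addLegendreSym 2 (p i) else 0 with hG
  set C : Matrix (Fin k) {j // addLegendreSym (-1) (p j) = 0} (ZMod 2) := L.submatrix id Subtype.val with hC
  set W₀ : Submodule (ZMod 2) (Fin k → ZMod 2) := LinearMap.ker Cᵀ.mulVecLin with hW₀
  set φε : (Fin k → ZMod 2) →ₗ[ZMod 2] ZMod 2 :=
    dotProductEquiv (ZMod 2) (Fin k) (fun i => addLegendreSym (-1) (p i)) with hφε
  set H₁ : Submodule (ZMod 2) (Fin k → ZMod 2) := W₀ ⊓ LinearMap.ker (Matrix.toBilin' G fun _ => 1) with hH₁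
  set W₇ : Submodule (ZMod 2) (Fin k → ZMod 2) := H₁ ⊓ LinearMap.ker φε with hW₇
  -- membership
  have hvC : ∀ u : Fin k → ZMod 2, u ᵥ* C = 0 ↔ ∀ j, addLegendreSym (-1) (p j) = 0 → (u ᵥ* L) j = 0 := by
    intro u
    constructor
    · intro h j hj
      have := congr_fun h ⟨j, hj⟩
      simpa [hC, Matrix.vecMul, dotProduct] using this
    · intro h
      ext ⟨j, hj⟩
      simpa [hC, Matrix.vecMul, dotProduct] using h j hj
  have hmem₀ : ∀ u, u ∈ W₀ ↔ ∀ j, addLegendreSym (-1) (p j) = 0 → (u ᵥ* L) j = 0 := by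
    intro u
    rw [hW₀, LinearMap.mem_ker, Matrix.mulVecLin_apply, Matrix.mulVec_transpose]
    exact hvC u
  have hBone : ∀ u, Matrix.toBilin' G (fun _ => 1) u = (fun i => addLegendreSym 2 (p i)) ⬝ᵥ u := by
    intro u
    rw [Matrix.toBilin'_apply', Matrix.dotProduct_mulVec]
    congr 1
    ext l
    exact one_vecMul_gram p l
  have hφε' : ∀ u, φε u = (fun i => addLegendreSym (-1) (p i)) ⬝ᵥ u := fun u => by
    rw [hφε]; rfl
  have hmem₇ : ∀ u, u ∈ W₇ ↔ (∀ j, addLegendreSym (-1) (p j) = 0 → (u ᵥ* L) j = 0) ∧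
      (fun i => addLegendreSym 2 (p i)) ⬝ᵥ u = 0 ∧ (fun i => addLegendreSym (-1) (p i)) ⬝ᵥ u = 0 := by
    intro u
    rw [hW₇, hH₁, Submodule.mem_inf, Submodule.mem_inf, hmem₀, LinearMap.mem_ker, LinearMap.mem_ker, hBone,
      hφε', and_assoc]
  have hWfin₀ : ∀ u : Fin k → ZMod 2,
      u ∈ (Finset.univ.filter fun u : Fin k → ZMod 2 =>
        ∀ j, addLegendreSym (-1) (p j) = 0 → (u ᵥ* L) j = 0) ↔ u ∈ W₀ := by
    intro u; rw [Finset.mem_filter, hmem₀]; simp only [Finset.mem_univ, true_and]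
  have hWfin₇ : ∀ u : Fin k → ZMod 2,
      u ∈ (Finset.univ.filter fun u : Fin k → ZMod 2 =>
        (∀ j, addLegendreSym (-1) (p j) = 0 → (u ᵥ* L) j = 0) ∧
          (fun i => addLegendreSym 2 (p i)) ⬝ᵥ u = 0 ∧ (fun i => addLegendreSym (-1) (p i)) ⬝ᵥ u = 0) ↔
        u ∈ W₇ := by
    intro u; rw [Finset.mem_filter, hmem₇]; simp only [Finset.mem_univ, true_and]
  -- Lemma 3 twice, bridged to the `BilinForm` radical
  have h0 := rank_gram_add_finrank G _ W₀ hWfin₀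
  have h7' := rank_gram_add_finrank G _ W₇ hWfin₇
  rw [inf_ker_gram_eq_inf_orthogonal G _ W₀ hWfin₀] at h0
  rw [inf_ker_gram_eq_inf_orthogonal G _ W₇ hWfin₇] at h7'
  -- `𝟙 ∈ W₀`, `B(𝟙, 𝟙) = Σ t = 0`, `ε ⬝ 𝟙 = 1`, `B` symmetric
  have hone : (fun _ => (1 : ZMod 2)) ∈ W₀ := by
    rw [hmem₀]
    intro j _
    simp only [Matrix.vecMul, dotProduct, one_mul]
    exact transposeA_sum_col p j
  have hB11 : Matrix.toBilin' G (fun _ => 1) (fun _ => 1) = 0 := by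
    rw [hBone]
    simp only [dotProduct, mul_one]
    exact sum_t_eq_zero_of_prod_mod_eight_seven p hodd h7
  have hε1 : φε (fun _ => 1) ≠ 0 := by
    rw [hφε']
    simp only [dotProduct, mul_one]
    rw [sum_eps_eq_one_of_prod_mod_four p hodd (by omega)]
    exact one_ne_zero
  have hsymm : (Matrix.toBilin' G).IsSymm := isSymm_toBilin'_of_symm G fun i l => by
    simp only [hG, Matrix.of_apply]
    congr 1
    · exact Finset.sum_congr rfl fun j _ => by ring
    · by_cases h : i = l
      · subst h; rfl
      · rw [if_neg h, if_neg (Ne.symm h)]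
  have honeH : (fun _ => (1 : ZMod 2)) ∈ H₁ := by
    rw [hH₁]
    exact Submodule.mem_inf.mpr ⟨hone, LinearMap.mem_ker.mpr hB11⟩
  -- the rank is `dim − dim rad`: bookkeeping of the two cases
  by_cases hδ : (fun _ => (1 : ZMod 2)) ∈ (Matrix.toBilin' G).orthogonal W₀
  · -- `𝟙 ∈ rad W₀`: `t ∈ col C`, `H₁ = W₀`, and `ε ⬝ ·` is not representable
    have ht : (fun i => addLegendreSym 2 (p i)) ∈ LinearMap.range C.mulVecLin := by
      obtain ⟨y, hy⟩ := exists_mulVec_eq_of_forall_vecMul_eq_zero C (fun i => addLegendreSym 2 (p i)) (by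
        intro w hw0
        have hw : w ∈ W₀ := (hmem₀ w).mpr ((hvC w).mp hw0)
        have := (LinearMap.BilinForm.mem_orthogonal_iff.mp hδ) w hw
        rw [hsymm.eq, hBone, dotProduct_comm] at this
        exact this)
      exact ⟨y, hy⟩
    rw [if_pos ht, mul_zero, add_zero]
    have hH₁W : H₁ = W₀ := by
      rw [hH₁]
      refine inf_eq_left.mpr fun w hw => ?_
      rw [LinearMap.mem_ker, hsymm.eq]
      exact (LinearMap.BilinForm.mem_orthogonal_iff.mp hδ) w hw
    have hrad : W₇ ⊓ (Matrix.toBilin' G).orthogonal W₇ =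
        (W₀ ⊓ (Matrix.toBilin' G).orthogonal W₀) ⊓ LinearMap.ker φε := by
      rw [hW₇, hH₁W]
      exact rad_inf_ker_of_mem_rad (Matrix.toBilin' G) hsymm W₀ φε (Submodule.mem_inf.mpr ⟨hone, hδ⟩) hε1
    have hdimW : Module.finrank (ZMod 2) ↥W₇ + 1 = Module.finrank (ZMod 2) ↥W₀ := by
      rw [hW₇, hH₁W]
      exact finrank_inf_ker_add_one W₀ φε hone hε1
    have hdimR : Module.finrank (ZMod 2) ↥((W₀ ⊓ (Matrix.toBilin' G).orthogonal W₀) ⊓ LinearMap.ker φε) + 1 =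
        Module.finrank (ZMod 2) ↥(W₀ ⊓ (Matrix.toBilin' G).orthogonal W₀) :=
      finrank_inf_ker_add_one _ φε (Submodule.mem_inf.mpr ⟨hone, hδ⟩) hε1
    rw [hrad] at h7'
    omega
  · -- `𝟙 ∉ rad W₀`: `t ∉ col C`, and the isotropic `𝟙` costs two
    have ht : (fun i => addLegendreSym 2 (p i)) ∉ LinearMap.range C.mulVecLin := by
      rintro ⟨y, hy⟩
      apply hδ
      refine LinearMap.BilinForm.mem_orthogonal_iff.mpr fun w hw => ?_
      rw [← hsymm.eq, hBone, ← hy, Matrix.mulVecLin_apply, dotProduct_comm, Matrix.dotProduct_mulVec]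
      have hw0 : w ᵥ* C = 0 := (hvC w).mpr ((hmem₀ w).mp hw)
      rw [hw0, zero_dotProduct]
    rw [if_neg ht, mul_one]
    -- a witness `n₀ ∈ W₀` with `B(𝟙, n₀) ≠ 0`
    have hn₀ : ∃ n₀ ∈ W₀, Matrix.toBilin' G (fun _ => 1) n₀ ≠ 0 := by
      by_contra h
      simp only [not_exists, not_and, not_not] at h
      exact hδ (LinearMap.BilinForm.mem_orthogonal_iff.mpr fun n hn => by rw [hsymm.eq]; exact h n hn)
    obtain ⟨n₀, hn₀W, hn₀⟩ := hn₀
    have hnotrad : (fun _ => (1 : ZMod 2)) ∉ W₀ ⊓ (Matrix.toBilin' G).orthogonal W₀ :=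
      not_mem_rad_of_not_mem_orthogonal (Matrix.toBilin' G) W₀ hδ
    have hradH : H₁ ⊓ (Matrix.toBilin' G).orthogonal H₁ =
        (W₀ ⊓ (Matrix.toBilin' G).orthogonal W₀) ⊔ (ZMod 2) ∙ (fun _ => (1 : ZMod 2)) := by
      rw [hH₁]
      exact rad_inf_ker_of_apply_self_eq_zero (Matrix.toBilin' G) hsymm W₀ hone hδ hB11
    have honeradH : (fun _ => (1 : ZMod 2)) ∈ H₁ ⊓ (Matrix.toBilin' G).orthogonal H₁ := by
      rw [hradH]
      exact Submodule.mem_sup_right (Submodule.mem_span_singleton_self _)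
    have hrad : W₇ ⊓ (Matrix.toBilin' G).orthogonal W₇ =
        (H₁ ⊓ (Matrix.toBilin' G).orthogonal H₁) ⊓ LinearMap.ker φε := by
      rw [hW₇]
      exact rad_inf_ker_of_mem_rad (Matrix.toBilin' G) hsymm H₁ φε honeradH hε1
    have hdimH : Module.finrank (ZMod 2) ↥H₁ + 1 = Module.finrank (ZMod 2) ↥W₀ := by
      rw [hH₁]
      exact finrank_inf_ker_add_one W₀ _ hn₀W hn₀
    have hdimW : Module.finrank (ZMod 2) ↥W₇ + 1 = Module.finrank (ZMod 2) ↥H₁ := by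
      rw [hW₇]
      exact finrank_inf_ker_add_one H₁ φε honeH hε1
    have hdimRH : Module.finrank (ZMod 2) ↥(H₁ ⊓ (Matrix.toBilin' G).orthogonal H₁) =
        Module.finrank (ZMod 2) ↥(W₀ ⊓ (Matrix.toBilin' G).orthogonal W₀) + 1 := by
      rw [hradH]
      exact finrank_sup_span_singleton _ hnotrad
    have hdimR : Module.finrank (ZMod 2) ↥((H₁ ⊓ (Matrix.toBilin' G).orthogonal H₁) ⊓ LinearMap.ker φε) + 1 =
        Module.finrank (ZMod 2) ↥(H₁ ⊓ (Matrix.toBilin' G).orthogonal H₁) :=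
      finrank_inf_ker_add_one _ φε honeradH hε1
    rw [hrad] at h7'
    omega

end Summit.BirchSwinnertonDyer.Rank1Residual.P2.AokiMonsky

end
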